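import Summits.QuantumFields.YangMills.Theorems.BalabanUVNodesPortU8LocTransport
import Summits.QuantumFields.YangMills.Theorems.BalabanUVNodesPortU8LResponse
import Summits.QuantumFields.YangMills.Theorems.BalabanUVNodesPortU8DecayConversion

/-!
# PORT PT-B (U8), g3 file 11 — TOWARD 27931 v11-G₄ «(ρ-tok)» (`bca3cb0d9af367ce`, SIGNED 04:06Z, the SIXTH AND LAST text): (i) under the DISPLAYED identification token
# Tok-182 (`recordHr = recordHrLocξ univ`, [15] (182) at B = 0) the GLOBAL (21)-Landau response data `recordGkL` IS the chart-unit localized data at the FULL window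
# (`recordGkLocWξ Finset.univ`) — 𝐔-block by name, 𝐉-block through the linearised current ([I] (1.8) at the flat background, port M); (ii) the HOMOGENEOUS generic row
# (a per-bond majorant `λ·η^j·e_b` gives `gauge ≤ λ·K·e^{−δ·dist}`); (iii) the centred lift does not DECREASE coarse torus distances and commutes with coarsening on off-wrap domains

Cell `ym-nodeO-ideate` ∕ `ym-balaban-port`, porter `ymgap-nodeO-port-PTB-1` (gen 3), item **stmt-QuantumFields-27931** `BalabanUVNodes.PortPieceLocalityU8`
(text v11-G₄ `bca3cb0d9af367ce`; director-ym №496∕№498; close HOLD until «SLOT RE-KEYED PT-B v11-G₄»).  `--supports stmt-QuantumFields-27931` (helper).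
[I] = [Balaban1987RG1], [15] = [Balaban1985Variational], [B6] = [Balaban1984PropagatorsII].

WHAT THIS FILE PROVES (theorems only; no `def ∕ instance ∕ notation ∕ sorry`; standard axioms):
* §1 ★★ `recordGkL_eq_recordGkLocWξ_univ` — at the fill, standing range, TokP9reg at `(k, K)`: Tok-182 at the label `l` ⟹ `∀ i, recordGkL … a l i = recordGkLocWξ … Finset.univ a l i`.
* §2 ★ `gauge_recordDom44J_cutTo_le_of_entryDecayOn_homog` — ✓`gauge_recordDom44J_cutTo_le_of_entryDecayOn` rescaled: clauses with constants `(λ, λP)` give `gauge ≤ λ·2(3 + P)e^{4δMc}∕α₂·e^{−δ·dist}`.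
* §3 `tdist_le_tdist_liftSiteCtr` (`tdist x y ≤ tdist (lift x) (lift y)` on coarse sites), `coarsenTo_eq_iterBlockOf`, `coarsenTo_liftSiteCtr_of_mem_domSites` (off-wrap `X`: `coarse (lift x) = lift (coarse x)`),
  `liftBondCtr_stencil_of_mem_domBonds` (the `d*d` stencil of `lift b` is the lift of the stencil of `b`).
HONEST FRAMING.  Bookkeeping under a DISPLAYED hypothesis (Tok-182 is asserted by nobody); nothing of Bałaban asserted∕ported∕discharged; 27931 OPEN · SIGNED v11-G₄ · close HOLD;
K0⁷ OPEN; NODE O 0∕1; COUNT 8∕28 · K 1∕4 UNMOVED; finite `𝕋⁴_{L^K}` at fixed ε — NOT continuum ∕ OS ∕ Clay; **the Yang–Mills mass gap (Clay) is NOT proved by any of this.**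
-/

noncomputable section

open scoped BigOperators Matrix.Norms.L2Operator
open Complex (I)

namespace Summit.QuantumFields.YangMills.Theorems.PortU8

open Literature.MathematicalPhysics.QuantumFieldTheory.Balaban1983to89
open Literature.MathematicalPhysics.QuantumFieldTheory.Balaban1983to89.Node00
open Literature.MathematicalPhysics.QuantumFieldTheory.Balaban1983to89.T4Continuum (T4Family)
open Literature.MathematicalPhysics.QuantumFieldTheory.Balaban1983to89.B5Eq118OneStroke (iterBlockOf iterBlock)
open Literature.MathematicalPhysics.QuantumFieldTheory.Balaban1983to89.B14.Eq213MaximalDomains (side)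
open Summit.QuantumFields.YangMills.Theorems.K0RecordFormatNames

variable (F : T4Family)

/-! ## §1  Under Tok-182 the global L-data IS the chart-unit localized data at the full window -/

/-- ★★ **`recordGkL = recordGkLocWξ Finset.univ` UNDER Tok-182** (at the fill, standing range, TokP9reg): the `𝐔`-block by the identification itself; the `𝐉`-block because both are
`ξ⁻³·(−i)·π(d*d ·)` of the SAME bond field — the rooted derivative `D = Hr + dφ` has the curls of `Hr` (✓`curlF_of_exact`), and `Hr = HrLocξ univ` (Tok-182).
[cite: Balaban1985Variational, (182) p.307, (21) p.281, Prop. 9 p.309; Balaban1987RG1, (1.8) p.261, (4.35) p.290] -/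
theorem recordGkL_eq_recordGkLocWξ_univ (a₀ ε₂₉ : ℝ) (ha₀ : 0 < a₀) (k K : ℕ) (hk : k + 1 ≤ (F.P K).m + (F.P K).K)
    (hreg : letI θ := thetaFill F a₀ ε₂₉; letI := θ.instVβ₁; letI := θ.instVβ₂; letI := θ.instιβ;
      AnalyticAt ℝ (fun B : recordW F a₀ ε₂₉ k K => fun (b : PBond (F.P K) 0) (i i' : Fin 2) => ((recordBgField F θ k K B b : SU 2) : Matrix (Fin 2) (Fin 2) ℂ) i i') 0)
    (a : (thetaFill F a₀ ε₂₉).ιβ) (l : RespLabel F k K)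
    (h182 : ∀ b : PBond (F.P K) 0, recordHr F (thetaFill F a₀ ε₂₉) k K a l b = recordHrLocξ F (thetaFill F a₀ ε₂₉) k K Finset.univ a l b)
    (i : Fin (recordChartDimJ F K)) :
    recordGkL F (thetaFill F a₀ ε₂₉) k K a l i = recordGkLocWξ F (thetaFill F a₀ ε₂₉) k K Finset.univ a l i := by
  classical
  letI := (thetaFill F a₀ ε₂₉).instVβ₁; letI := (thetaFill F a₀ ε₂₉).instVβ₂; letI := (thetaFill F a₀ ε₂₉).instιβ
  obtain ⟨⟨b, t⟩, rfl⟩ := (chartEquivJ F K).surjective i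
  rcases t with c | c
  · rw [recordGkL_inl, recordGkLocWξ_inl]
    congr 1
    ext i i'
    simp only [Matrix.of_apply, h182]
  · rw [recordGkL_inr, recordGkLocWξ_inr, recordJLocξ_eq]
    have hd2 : ContDiffAt ℝ 2 (fun B : recordW F a₀ ε₂₉ k K => fun (b : PBond (F.P K) 0) (i i' : Fin 2) =>
        ((recordBgField F (thetaFill F a₀ ε₂₉) k K B b : SU 2) : Matrix (Fin 2) (Fin 2) ℂ) i i') 0 := hreg.contDiffAt
    obtain ⟨U', hU'eq, hU'⟩ := hasFDerivAt_bgField_of_entries F (thetaFill F a₀ ε₂₉) k K (hd2.differentiableAt (by norm_num))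
    have hE : DifferentiableAt ℝ (recordEmbJ F (thetaFill F a₀ ε₂₉) k K) 0 :=
      (contDiffAt_recordEmbJ_of F (thetaFill F a₀ ε₂₉) k K hk ha₀ (contDiffAt_matrix_of_entries hd2)).differentiableAt (by norm_num)
    rw [recordGkJ_inr_eq F (thetaFill F a₀ ε₂₉) k K hk ha₀ U' hU' hE a l b c]
    -- `U′ δ β = Matrix.of (recordD … β)`, and `recordD = Hr + dφ` entrywise
    have hUD : ∀ β : PBond (F.P K) 0, U' (Pi.single l.1 (Pi.single l.2 ((thetaFill F a₀ ε₂₉).bV a))) β = Matrix.of (recordD F (thetaFill F a₀ ε₂₉) k K a l β) := fun β => hU'eq _ β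
    set φ : Site (F.P K) 0 → MatA 2 := fun x => -Matrix.of (fun i i' => landauPotC F k K (fun b' => recordD F (thetaFill F a₀ ε₂₉) k K a l b' i i') x) with hφ
    have hsplit : ∀ β : PBond (F.P K) 0, (Matrix.of (recordD F (thetaFill F a₀ ε₂₉) k K a l β) : MatA 2) = Matrix.of (recordHr F (thetaFill F a₀ ε₂₉) k K a l β) + (φ β.src - φ (β.src.shift β.dir)) := by
      intro β; ext i i'
      rw [Matrix.add_apply, Matrix.sub_apply, Matrix.of_apply, Matrix.of_apply, recordD_eq_recordHr_add]
      simp only [hφ, Matrix.neg_apply, Matrix.of_apply, PBond.tgt]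
      ring
    have hcurl : ∀ (x : Site (F.P K) 0) (μ ν : Fin (F.P K).d),
        U' (Pi.single l.1 (Pi.single l.2 ((thetaFill F a₀ ε₂₉).bV a))) ⟨x, μ⟩ + U' (Pi.single l.1 (Pi.single l.2 ((thetaFill F a₀ ε₂₉).bV a))) ⟨x.shift μ, ν⟩ -
          U' (Pi.single l.1 (Pi.single l.2 ((thetaFill F a₀ ε₂₉).bV a))) ⟨x.shift ν, μ⟩ - U' (Pi.single l.1 (Pi.single l.2 ((thetaFill F a₀ ε₂₉).bV a))) ⟨x, ν⟩ =
        (Matrix.of (recordHrLocξ F (thetaFill F a₀ ε₂₉) k K Finset.univ a l ⟨x, μ⟩) : MatA 2) + Matrix.of (recordHrLocξ F (thetaFill F a₀ ε₂₉) k K Finset.univ a l ⟨x.shift μ, ν⟩) -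
          Matrix.of (recordHrLocξ F (thetaFill F a₀ ε₂₉) k K Finset.univ a l ⟨x.shift ν, μ⟩) - Matrix.of (recordHrLocξ F (thetaFill F a₀ ε₂₉) k K Finset.univ a l ⟨x, ν⟩) := by
      intro x μ ν
      rw [hUD, hUD, hUD, hUD, curlF_of_exact (D := fun β => (Matrix.of (recordD F (thetaFill F a₀ ε₂₉) k K a l β) : MatA 2)) (Hr := fun β => (Matrix.of (recordHr F (thetaFill F a₀ ε₂₉) k K a l β) : MatA 2)) hsplit x μ ν]
      simp only [h182]
    simp only [hcurl]

/-! ## §2  The homogeneous generic row -/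

variable {F} in
/-- ★ **THE GENERIC ROW, HOMOGENEOUS FORM**: if the `𝐔`-entries `D` of the cut vector obey the three scaled clauses with constant `λ > 0` and its `𝐉`-block the bound with constant `λ·P`
(`P ≥ 0`) at the rate `e^{−δ·tdist}` on the bonds of `X`, then `gauge ≤ λ · (2(3 + P)e^{4δMc}∕α₂) · e^{−δ·dist(y, X)}` — ✓`gauge_recordDom44J_cutTo_le_of_entryDecayOn` applied to the vector
divided by `λ` (gauge is positively homogeneous). [cite: Balaban1987RG1, (4.4)–(4.5) pp.281–282 (bookkeeping)] -/
theorem gauge_recordDom44J_cutTo_le_of_entryDecayOn_homog {Mc k K : ℕ} (hMc : McGuard F Mc) (hK : recordK₀ F Mc k ≤ K)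
    (X : (recordDomSys F Mc k K).Dom) (y : RespLabel F k K) (g : Fin (recordChartDimJ F K) → ℂ) (D : PBond (F.P K) 0 → Fin 2 → Fin 2 → ℂ)
    {α₂ lam P δ₉ : ℝ} (hα : 0 < α₂) (hlam : 0 < lam) (hP : 0 ≤ P) (hδ : 0 ≤ δ₉)
    (hU : ∀ b ∈ domBonds F Mc k K X, chartMatU F K (B12FormatPlus.cutTo (recordCXJ F Mc k K X) g) b = Matrix.of (D b))
    (hdec : ∀ b ∈ domBonds F Mc k K X,
        ‖D b‖ ≤ lam * (F.P K).eta (k + 1) * Real.exp (-(δ₉ * (Site.tdist (coarsenTo (k + 1) b.src) y.2 : ℝ))) ∧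
        (∀ ν : Fin (F.P K).d, ‖D ⟨b.src.shift ν, b.dir⟩ - D b‖ ≤ lam * (F.P K).eta (k + 1) ^ 2 * Real.exp (-(δ₉ * (Site.tdist (coarsenTo (k + 1) b.src) y.2 : ℝ)))) ∧
        ‖∑ ν : Fin (F.P K).d, (D ⟨b.src.shift ν, b.dir⟩ - (2 : ℂ) • D b + D ⟨b.src.unshift ν, b.dir⟩)‖ ≤
          lam * (F.P K).eta (k + 1) ^ 3 * Real.exp (-(δ₉ * (Site.tdist (coarsenTo (k + 1) b.src) y.2 : ℝ))))
    (hJ : ∀ b ∈ domBonds F Mc k K X, ‖chartMatJc F K (B12FormatPlus.cutTo (recordCXJ F Mc k K X) g) b‖ ≤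
        lam * P * Real.exp (-(δ₉ * (Site.tdist (coarsenTo (k + 1) b.src) y.2 : ℝ)))) :
    gauge (recordDom44J F Mc k K X α₂) (B12FormatPlus.cutTo (recordCXJ F Mc k K X) g) ≤
      lam * (2 * (2 * 1 + P + 1) * Real.exp (4 * δ₉ * Mc) / α₂) * Real.exp (-δ₉ * (recordSiteGeom F Mc k K).distD y X) := by
  -- the rescaled data
  have hcut : B12FormatPlus.cutTo (recordCXJ F Mc k K X) ((lam⁻¹ : ℝ) • g) = (lam⁻¹ : ℝ) • B12FormatPlus.cutTo (recordCXJ F Mc k K X) g := by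
    funext i
    simp only [B12FormatPlus.cutTo_apply, Pi.smul_apply]
    split_ifs <;> simp
  have h1 := gauge_recordDom44J_cutTo_le_of_entryDecayOn F hMc hK X y ((lam⁻¹ : ℝ) • g) (fun b => (lam⁻¹ : ℝ) • D b) hα zero_le_one hP hδ
    (fun b hb => by
      rw [hcut, chartMatU_real_smul, hU b hb]
      ext i i'; simp [Matrix.smul_apply])
    (fun b hb => by
      obtain ⟨h1, h2, h3⟩ := hdec b hb
      have hl : ‖((lam⁻¹ : ℝ) : ℂ)‖ = lam⁻¹ := by rw [Complex.norm_real, Real.norm_of_nonneg (inv_nonneg.2 hlam.le)]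
      refine ⟨?_, fun ν => ?_, ?_⟩
      · rw [← Complex.coe_smul, norm_smul, hl]
        calc lam⁻¹ * ‖D b‖ ≤ lam⁻¹ * (lam * (F.P K).eta (k + 1) * Real.exp (-(δ₉ * (Site.tdist (coarsenTo (k + 1) b.src) y.2 : ℝ)))) :=
              mul_le_mul_of_nonneg_left h1 (inv_nonneg.2 hlam.le)
          _ = 1 * (F.P K).eta (k + 1) * Real.exp (-(δ₉ * (Site.tdist (coarsenTo (k + 1) b.src) y.2 : ℝ))) := by field_simp
      · rw [← smul_sub, ← Complex.coe_smul, norm_smul, hl]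
        calc lam⁻¹ * ‖D ⟨b.src.shift ν, b.dir⟩ - D b‖ ≤ lam⁻¹ * (lam * (F.P K).eta (k + 1) ^ 2 * Real.exp (-(δ₉ * (Site.tdist (coarsenTo (k + 1) b.src) y.2 : ℝ)))) :=
              mul_le_mul_of_nonneg_left (h2 ν) (inv_nonneg.2 hlam.le)
          _ = 1 * (F.P K).eta (k + 1) ^ 2 * Real.exp (-(δ₉ * (Site.tdist (coarsenTo (k + 1) b.src) y.2 : ℝ))) := by field_simp
      · have hre : ∑ ν : Fin (F.P K).d, (((lam⁻¹ : ℝ) • D ⟨b.src.shift ν, b.dir⟩) - (2 : ℂ) • ((lam⁻¹ : ℝ) • D b) + (lam⁻¹ : ℝ) • D ⟨b.src.unshift ν, b.dir⟩) =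
            (lam⁻¹ : ℝ) • ∑ ν : Fin (F.P K).d, (D ⟨b.src.shift ν, b.dir⟩ - (2 : ℂ) • D b + D ⟨b.src.unshift ν, b.dir⟩) := by
          rw [Finset.smul_sum]
          refine Finset.sum_congr rfl fun ν _ => ?_
          rw [smul_add, smul_sub, smul_comm]
        rw [hre, ← Complex.coe_smul, norm_smul, hl]
        calc lam⁻¹ * ‖∑ ν : Fin (F.P K).d, (D ⟨b.src.shift ν, b.dir⟩ - (2 : ℂ) • D b + D ⟨b.src.unshift ν, b.dir⟩)‖
            ≤ lam⁻¹ * (lam * (F.P K).eta (k + 1) ^ 3 * Real.exp (-(δ₉ * (Site.tdist (coarsenTo (k + 1) b.src) y.2 : ℝ)))) := mul_le_mul_of_nonneg_left h3 (inv_nonneg.2 hlam.le)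
          _ = 1 * (F.P K).eta (k + 1) ^ 3 * Real.exp (-(δ₉ * (Site.tdist (coarsenTo (k + 1) b.src) y.2 : ℝ))) := by field_simp)
    (fun b hb => by
      rw [hcut, chartMatJc_real_smul, norm_smul, Complex.norm_real, Real.norm_of_nonneg (inv_nonneg.2 hlam.le)]
      calc lam⁻¹ * ‖chartMatJc F K (B12FormatPlus.cutTo (recordCXJ F Mc k K X) g) b‖ ≤ lam⁻¹ * (lam * P * Real.exp (-(δ₉ * (Site.tdist (coarsenTo (k + 1) b.src) y.2 : ℝ)))) :=
            mul_le_mul_of_nonneg_left (hJ b hb) (inv_nonneg.2 hlam.le)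
        _ = P * Real.exp (-(δ₉ * (Site.tdist (coarsenTo (k + 1) b.src) y.2 : ℝ))) := by field_simp)
  rw [hcut, gauge_smul_of_nonneg (inv_nonneg.2 hlam.le), smul_eq_mul] at h1
  have := mul_le_mul_of_nonneg_left h1 hlam.le
  rw [← mul_assoc, mul_inv_cancel₀ hlam.ne', one_mul] at this
  linarith [this]

/-! ## §3  Torus distances and coarsening under the centred lift -/

/-- Least-absolute-value residues of the same integer in a torus and in a bigger one (`2|d| < 2N ≤ N′`): the bigger residue IS `d`, the smaller one is at most `|d|`. [folklore] -/
theorem natAbs_valMinAbs_cast_le {N N' : ℕ} [NeZero N] [NeZero N'] (hNN : 2 * N ≤ N') {d : ℤ} (hd : |d| < N) :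
    (((d : ℤ) : ZMod N)).valMinAbs.natAbs ≤ (((d : ℤ) : ZMod N')).valMinAbs.natAbs := by
  -- in the big torus `d` is its own representative
  have hv' : (((d : ℤ) : ZMod N')).valMinAbs = d := by
    rw [ZMod.valMinAbs_spec]
    have h2 : ((2 * N : ℕ) : ℤ) ≤ N' := by exact_mod_cast hNN
    push_cast at h2
    refine ⟨rfl, ?_, ?_⟩
    · have := neg_abs_le d; linarith
    · have := le_abs_self d; linarith
  -- in the small torus the representative `v` has `|v| ≤ |d|`
  set v := (((d : ℤ) : ZMod N)).valMinAbs with hv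
  have hb := ((ZMod.valMinAbs_spec ((d : ℤ) : ZMod N) v).1 rfl).2
  have hmod : ((v : ℤ) : ZMod N) = ((d : ℤ) : ZMod N) := by rw [hv, ZMod.coe_valMinAbs]
  rw [ZMod.intCast_eq_intCast_iff, Int.modEq_iff_dvd] at hmod
  obtain ⟨t, ht⟩ := hmod
  have hvle : |v| ≤ |d| := by
    by_cases ht0 : t = 0
    · rw [ht0, mul_zero, sub_eq_zero] at ht; rw [ht]
    · have h1 : (N : ℤ) ≤ |d - v| := by rw [ht, abs_mul, Nat.abs_cast]; exact le_mul_of_one_le_right (Nat.cast_nonneg _) (Int.one_le_abs ht0)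
      have h2 : 2 * |v| ≤ N := by rcases abs_cases v with ⟨h, _⟩ | ⟨h, _⟩ <;> rw [h] <;> linarith [hb.1, hb.2]
      have h3 : |d - v| ≤ |d| + |v| := abs_sub d v
      linarith
  rw [hv']
  have : (v.natAbs : ℤ) ≤ d.natAbs := by rw [Int.natCast_natAbs, Int.natCast_natAbs]; exact hvle
  exact_mod_cast this

/-- **The centred lift does not DECREASE torus distances**: `tdist x y ≤ tdist (lift x) (lift y)` (standing range `j ≤ m + K`). [cite: Balaban1987RG1, (1.21) p.264 (bookkeeping)] -/
theorem tdist_le_tdist_liftSiteCtr (K j : ℕ) (hj : j ≤ F.m + K) (x y : Site (F.P K) j) :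
    Site.tdist x y ≤ Site.tdist (liftSiteCtr F K j x) (liftSiteCtr F K j y) := by
  haveI : NeZero ((F.P K).sitesPerDir j) := ⟨(F.P K).sitesPerDir_ne_zero j⟩
  haveI : NeZero ((F.P (K + 1)).sitesPerDir j) := ⟨(F.P (K + 1)).sitesPerDir_ne_zero j⟩
  have hNN : 2 * (F.P K).sitesPerDir j ≤ (F.P (K + 1)).sitesPerDir j := by
    rw [sitesPerDir_succ_vol F K j hj]; exact Nat.mul_le_mul_right _ (by have := F.hL.2; omega)
  unfold Site.tdist
  refine Finset.sum_le_sum fun μ _ => ?_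
  rw [min_val_sub_eq_natAbs_valMinAbs, min_val_sub_eq_natAbs_valMinAbs]
  -- both differences are the residue of the same integer `d = vma x − vma y`, `|d| < N`
  have hd : |((x μ).valMinAbs : ℤ) - ((y μ).valMinAbs : ℤ)| < (F.P K).sitesPerDir j := by
    have h1 := valMinAbs_mem_Ioc' F K j x μ; have h2 := valMinAbs_mem_Ioc' F K j y μ
    rw [abs_lt]; constructor <;> linarith [h1.1, h1.2, h2.1, h2.2]
  have hx : liftSiteCtr F K j x μ - liftSiteCtr F K j y μ = (((((x μ).valMinAbs : ℤ) - ((y μ).valMinAbs : ℤ) : ℤ)) : ZMod ((F.P (K + 1)).sitesPerDir j)) := by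
    push_cast; rfl
  have hxy : x μ - y μ = (((((x μ).valMinAbs : ℤ) - ((y μ).valMinAbs : ℤ) : ℤ)) : ZMod ((F.P K).sitesPerDir j)) := by
    rw [Int.cast_sub, ZMod.coe_valMinAbs, ZMod.coe_valMinAbs]
  rw [hx, hxy]
  exact natAbs_valMinAbs_cast_le hNN hd

/-- `coarsenTo = iterBlockOf` (the two names for the iterated block map). [cite: Balaban1984PropagatorsI, (1.18) p.20 (bookkeeping)] -/
theorem coarsenTo_eq_iterBlockOf {P : Params} : ∀ (n : ℕ) (x : Site P 0), coarsenTo n x = iterBlockOf n x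
  | 0, _ => rfl
  | n + 1, x => by
    show blockOf (coarsenTo n x) = blockOf (iterBlockOf n x)
    rw [coarsenTo_eq_iterBlockOf n x]

variable {F} in
/-- **On an off-wrap domain the coarse site of a fine site is off the antipodal coarse layer**: `⌊val(x_i) ∕ L^{k+1}⌋ ≠ N_{k+1}∕2` (tiled range). [cite: Balaban1987RG1, (1.21) p.264 (bookkeeping)] -/
theorem val_div_pow_ne_half_of_mem_domSites {Mc k K : ℕ} (hMc : McGuard F Mc) (hK : recordK₀ F Mc k ≤ K) {X : (recordDomSys F Mc k K).Dom}
    (hX : X ∉ recordWrapCtr F Mc k K) {x : Site (F.P K) 0} (hx : x ∈ Sect2.domSites (F.P K) Mc (k + 1) X) (μ : Fin (F.P K).d) :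
    (x μ).val / F.L ^ (k + 1) ≠ (F.P K).sitesPerDir (k + 1) / 2 := by
  intro hv
  rw [mem_domSites_iff hMc hK X x] at hx
  apply not_onSeamCtr_of_mem hX hx
  refine ⟨μ, ?_⟩
  show ((((x μ).val / side (F.P K).L Mc (k + 1) : ℕ) : ZMod (Sect2.domCount (F.P K) Mc (k + 1)))).valMinAbs = _
  have hside : side (F.P K).L Mc (k + 1) = F.L ^ (k + 1) * Mc := by unfold side; simp
  have hN : (F.P K).sitesPerDir (k + 1) = Sect2.domCount (F.P K) Mc (k + 1) * Mc := recordN_eq_domCount_mul hMc hK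
  obtain ⟨t, ht⟩ := even_domCount hMc hK
  have hMc0 : 0 < Mc := by obtain ⟨c, rfl⟩ := hMc; exact Nat.pow_pos (by have := F.hL.2; omega)
  rw [hside, ← Nat.div_div_eq_div_mul, hv, hN, ht, show (t + t) * Mc / 2 = t * Mc by rw [← two_mul, mul_assoc, Nat.mul_div_cancel_left _ two_pos],
    Nat.mul_div_cancel _ hMc0, show (t + t) / 2 = t by omega, ZMod.valMinAbs_natCast_of_le_half (by omega)]

variable {F} in
/-- **On an off-wrap domain the centred lift commutes with coarsening**: for `x ∈ X`, `X ∉ recordWrapCtr` (tiled range), `coarse (lift x) = lift (coarse x)`.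
[cite: Balaban1987RG1, (1.21) p.264 (bookkeeping)] -/
theorem coarsenTo_liftSiteCtr_of_mem_domSites {Mc k K : ℕ} (hMc : McGuard F Mc) (hK : recordK₀ F Mc k ≤ K) {X : (recordDomSys F Mc k K).Dom}
    (hX : X ∉ recordWrapCtr F Mc k K) {x : Site (F.P K) 0} (hx : x ∈ Sect2.domSites (F.P K) Mc (k + 1) X) :
    coarsenTo (k + 1) (liftSiteCtr F K 0 x) = liftSiteCtr F K (k + 1) (coarsenTo (k + 1) x) := by
  have hk : k + 1 ≤ F.m + K := by unfold recordK₀ at hK; omega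
  haveI : NeZero ((F.P K).sitesPerDir 0) := ⟨(F.P K).sitesPerDir_ne_zero 0⟩
  rw [coarsenTo_eq_iterBlockOf, coarsenTo_eq_iterBlockOf]
  set z : Fin 4 → ℤ := fun i => ((x (Fin.cast (F.P_d K).symm i)).valMinAbs : ℤ) with hzdef
  have hxz : siteOfInt F K 0 z = x := siteOfInt_valMinAbs F K 0 x
  have hzc : ∀ i, z i * 2 ∈ Set.Ioc (-((F.P K).sitesPerDir 0 : ℤ)) ((F.P K).sitesPerDir 0) := fun i => valMinAbs_mem_Ioc' F K 0 x _
  have hM0 : (0 : ℤ) < (F.L : ℤ) ^ (k + 1) := by have := (F.P K).L_pos; positivity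
  have hN0 : ((F.P K).sitesPerDir 0 : ℤ) = (F.L : ℤ) ^ (k + 1) * (F.P K).sitesPerDir (k + 1) := sitesPerDir_zero_eq_pow_mul F K (k + 1) hk
  set hn : ℕ := F.L ^ (F.m + K - (k + 1)) with hhn
  have hNn : (F.P K).sitesPerDir (k + 1) = 2 * hn := rfl
  set h : ℤ := (hn : ℤ) with hhdef
  have hh : ((F.P K).sitesPerDir (k + 1) : ℤ) = 2 * h := by rw [hNn]; push_cast; rfl
  have hNh : ((F.P K).sitesPerDir (k + 1) / 2 : ℕ) = hn := by rw [hNn]; omega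
  -- the coarse label `z / M` is centred
  have hzj : ∀ i, (z i / (F.L : ℤ) ^ (k + 1)) * 2 ∈ Set.Ioc (-((F.P K).sitesPerDir (k + 1) : ℤ)) ((F.P K).sitesPerDir (k + 1)) := by
    intro i
    have h2 := two_mul_abs_ediv_pow_le F K (k + 1) hk (two_mul_abs_valMinAbs_le F K 0 x (Fin.cast (F.P_d K).symm i))
    have h2' : |z i / (F.L : ℤ) ^ (k + 1)| ≤ h := by rw [hh] at h2; simp only [hzdef]; linarith
    rw [abs_le] at h2'
    refine ⟨?_, by rw [hh]; linarith [h2'.2]⟩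
    rw [hh]
    -- exclude `z i / M = -h`
    suffices hne : z i / (F.L : ℤ) ^ (k + 1) ≠ -h by
      have : -h < z i / (F.L : ℤ) ^ (k + 1) := lt_of_le_of_ne h2'.1 (Ne.symm hne)
      linarith
    intro heq
    have hvne := val_div_pow_ne_half_of_mem_domSites hMc hK hX hx (Fin.cast (F.P_d K).symm i)
    rw [hNh] at hvne
    -- `val = z i + N0` (here `z i < 0`), so `val / M = z i / M + N_{k+1} = -h + 2h = h`
    have hneg : z i < 0 := by
      have h1 : (1 : ℤ) ≤ h := by
        have : (2 : ℤ) ≤ (F.P K).sitesPerDir (k + 1) := by exact_mod_cast (F.P K).one_lt_sitesPerDir (k + 1)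
        linarith
      have hhi : z i < -h * (F.L : ℤ) ^ (k + 1) + (F.L : ℤ) ^ (k + 1) := by
        have := Int.lt_ediv_add_one_mul_self (z i) hM0; rw [heq] at this; linarith
      nlinarith
    have hval : ((x (Fin.cast (F.P_d K).symm i)).val : ℤ) = z i + (F.P K).sitesPerDir 0 := by
      have hvd := ZMod.valMinAbs_def_pos (x (Fin.cast (F.P_d K).symm i))
      have hzi : z i = (x (Fin.cast (F.P_d K).symm i)).valMinAbs := rfl
      rw [hzi] at hneg ⊢
      split_ifs at hvd with hc
      · rw [hvd] at hneg; exact absurd hneg (not_lt.2 (Int.natCast_nonneg _))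
      · linarith
    apply hvne
    apply @Nat.cast_injective ℤ
    rw [Int.natCast_div, hval, hN0]
    push_cast
    rw [show z i + (F.L : ℤ) ^ (k + 1) * ((F.P K).sitesPerDir (k + 1) : ℤ) = z i + ((F.P K).sitesPerDir (k + 1) : ℤ) * (F.L : ℤ) ^ (k + 1) by ring,
      Int.add_mul_ediv_right _ _ hM0.ne', heq, hh]
    ring
  rw [← hxz, liftSiteCtr_iterBlockOf_of F K (k + 1) hk z hzc hzj, liftSiteCtr_siteOfInt F K 0 z hzc]

end Summit.QuantumFields.YangMills.Theorems.PortU8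

end
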